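import Literature.NumberTheory.EllipticCurves.ZpExtensionGaloisTwistLevelDualProofs
import HarnessLib

/-!
# Change of level on the DUAL side, GLOBAL form: `H¹(ι^D) y = 0` for a class `y ∈ H¹(Γ_K, E[p^J](χ_u)^D)`
# killed by `p^{J−j}` when `Hom(E[p^{J−j}], μ)` has no twisted `Γ_K`-invariants (proofs)

Topic `NumberTheory/EllipticCurves`; namespace `WeierstrassCurve`. THEOREMS ONLY (no definition, no named fact,
no instance) — third proofs file of `ZpExtensionGaloisTwistLevel.lean` (maps `ι = W.twistedTorsionIncl`,
`π = W.twistedTorsionMulPow`, `ι^D = W.twistedTorsionInclDual` between `M_j = E[p^j](χ_u) ⊆ M_J = E[p^J](χ_u)`,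
`j ≤ J`, and the Tate duals `M^D = Hom(·, μ_{p^J})`), sibling of `ZpExtensionGaloisTwistLevelDualProofs`
(`map_twistedTorsionInclDual_eq_zero_of_res_eq_zero`: the same conclusion from LOCAL triviality at an omitted
prime, Greenberg p. 123).

Greenberg (LNM 1716, §4 p. 124): «Since `S_{M*}(F)` is finite and `M*(F) = 0`, we can conclude that the map `γ`
is surjective.»  At finite level the rôle of `M*(F) = 0` is played by the following lemma, which turns the bound
"`p^{J−j}` kills the dual Selmer class `y`" into the vanishing of the Poitou–Tate obstruction `H¹(ι^D) y` after
the change of level `j ↦ J` (the EVENTUAL form of Greenberg's surjectivity):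

* `exists_tateDual_comp_twistedTorsionMulPow_eq_of_forall_apply_eq_zero` — a homomorphism `m : E[p^J] → μ`
  vanishing on `ker π` descends through `π`: `m = m' ∘ π`;
* **`map_twistedTorsionInclDual_eq_zero_of_smul_eq_zero`** — if `p^{J−j} · y = 0` and every `m ∈ Hom(E[p^J], μ_{p^J})`
  whose restriction to `ker π = E[p^{J−j}]` is invariant under the (Tate-dual twisted) `Γ_K`-action vanishes on
  `ker π` («`H⁰(Γ_K, Hom(E[p^{J−j}](χ_u), μ)) = 0`», which for an elliptic curve holds as soon as `E(K)[p] = 0`,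
  Weil pairing — not proved here), then `H¹(ι^D) y = 0` in `H¹(Γ_K, E[p^j](χ_u)^D)`; granted the divisibility of
  `E(K̄)`.

Cocycle proof: `p^{J−j} φ = ∂m`; for `R ∈ ker π`, `(g m − m)(R) = (p^{J−j} φ(g))(R) = φ(g)(p^{J−j} R) = 0`, so `m|_{ker π}`
is invariant, hence `m` kills `ker π` and `m = m' ∘ π`; then `(ι^D φ(g))(π S₁) = φ(g)(p^{J−j} S₁) = (g m − m)(S₁)
= (g m' − m')(π S₁)`, i.e. `ι^D ∘ φ = ∂m'`.

References: R. Greenberg, LNM 1716 (1999), §4 pp. 122–125 [GreenbergLNM1716]; J.-P. Serre, *Galois Cohomology* (1997),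
I §2 [SerreGaloisCohomology1997]; J. S. Milne, *Arithmetic Duality Theorems* (2006), I §2 [MilneADT2006].
-/

noncomputable section

open CategoryTheory Field
open scoped ContRepresentation

universe u

namespace WeierstrassCurve

open Literature.NumberTheory.EllipticCurves Literature.NumberTheory.GaloisRepresentations
open Literature.NumberTheory.GaloisRepresentations.DiscreteGaloisModule (TateDual tateDual MuCarrier)

variable {K : Type u} [Field K] (W : WeierstrassCurve K) [W.IsElliptic] (p : ℕ) [Fact p.Prime]
  (κ : ZpExtension K p) {j J : ℕ} (hjJ : j ≤ J) (u : ℤ) (hu : (p : ℤ) ∣ u - 1)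

/-- **Descent through `π` of a homomorphism vanishing on `ker π`.** If `m ∈ Hom(E[p^J], μ_{p^J})` vanishes on
`ker π` (`π : E[p^J] → E[p^j]`, `P ↦ p^{J−j} P`, onto by the divisibility of `E(K̄)`), there is `m' ∈ Hom(E[p^j], μ_{p^J})`
with `m' (π P) = m P`. [cite: MilneADT2006, Ch. I §2] -/
theorem exists_tateDual_comp_twistedTorsionMulPow_eq_of_forall_apply_eq_zero (hdiv : W.zsmul_geomPoints_surjective)
    {m : TateDual K (W.geomTorsion ((p ^ J : ℕ) : ℤ)) (p ^ J)}
    (hm : ∀ R : W.geomTorsion ((p ^ J : ℕ) : ℤ), W.twistedTorsionMulPow p κ hjJ u hu R = 0 → m R = 0) :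
    ∃ m' : TateDual K (W.geomTorsion ((p ^ j : ℕ) : ℤ)) (p ^ J),
      ∀ P, m' (W.twistedTorsionMulPow p κ hjJ u hu P) = m P := by
  have hsurj := W.twistedTorsionMulPow_surjective p κ hjJ u hu hdiv
  have hwd : ∀ P Q, W.twistedTorsionMulPow p κ hjJ u hu P = W.twistedTorsionMulPow p κ hjJ u hu Q →
      m P = m Q := fun P Q h ↦ by
    rw [← sub_eq_zero, ← map_sub]
    exact hm _ (by rw [map_sub, h, sub_self])
  refine ⟨AddMonoidHom.mk' (fun S ↦ m (Classical.choose (hsurj S))) fun S T ↦ ?_, fun P ↦ ?_⟩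
  · rw [← map_add]
    apply hwd
    rw [map_add, Classical.choose_spec (hsurj S), Classical.choose_spec (hsurj T),
      Classical.choose_spec (hsurj (S + T))]
  · exact hwd _ _ (Classical.choose_spec (hsurj _))

section Dual

variable [Finite (W.geomTorsion ((p ^ j : ℕ) : ℤ))] [Finite (W.geomTorsion ((p ^ J : ℕ) : ℤ))]

/-- **`H¹(ι^D) y = 0` for `p^{J−j} · y = 0` when `Hom(ker π, μ)` has no twisted invariants** (the finite-level form
of Greenberg's «`M*(F) = 0` ⟹ `γ` surjective», p. 124): for `y ∈ H¹(Γ_K, E[p^J](χ_u)^D)` with `p^{J−j} · y = 0`, if every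
`m ∈ Hom(E[p^J], μ_{p^J})` whose restriction to `ker π` is invariant under the Tate-dual action of `Γ_K` vanishes on `ker π`,
then `H¹(ι^D) y = 0` in `H¹(Γ_K, E[p^j](χ_u)^D)`; granted the divisibility of `E(K̄)`.
[cite: GreenbergLNM1716, §4 pp. 123–125] [cite: SerreGaloisCohomology1997, I §2.2] -/
theorem map_twistedTorsionInclDual_eq_zero_of_smul_eq_zero (hdiv : W.zsmul_geomPoints_surjective)
    (hinv : ∀ m : TateDual K (W.geomTorsion ((p ^ J : ℕ) : ℤ)) (p ^ J),
      (∀ (g : absoluteGaloisGroup K) (R : W.geomTorsion ((p ^ J : ℕ) : ℤ)), W.twistedTorsionMulPow p κ hjJ u hu R = 0 →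
        ((W.twistedTorsionGaloisModule p κ J u hu).tateDual (p ^ J) g m - m) R = 0) →
      ∀ R : W.geomTorsion ((p ^ J : ℕ) : ℤ), W.twistedTorsionMulPow p κ hjJ u hu R = 0 → m R = 0)
    (y : galoisCohomology ((W.twistedTorsionGaloisModule p κ J u hu).tateDual (p ^ J)) 1)
    (hy : (p ^ (J - j)) • y = 0) :
    galoisCohomology.map (W.twistedTorsionInclDual p κ hjJ u hu) 1 y = 0 := by
  obtain ⟨φ, rfl⟩ := oneCocycleClass_surjective _ y
  -- `p^{J-j} φ = ∂m`
  have hs := oneCocycleClass_smul ((W.twistedTorsionGaloisModule p κ J u hu).tateDual (p ^ J)).toTopRep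
    ((p ^ (J - j) : ℕ) : ℤ) φ
  conv at hs => rhs; rw [Nat.cast_smul_eq_nsmul]
  have hy' : oneCocycleClass ((W.twistedTorsionGaloisModule p κ J u hu).tateDual (p ^ J)).toTopRep
      (((p ^ (J - j) : ℕ) : ℤ) • φ) = 0 := hs.trans hy
  rw [oneCocycleClass_eq_zero_iff] at hy'
  obtain ⟨m, hm⟩ := hy'
  have hm' : ∀ g : absoluteGaloisGroup K, ((p ^ (J - j) : ℕ) : ℤ) • φ.1 g =
      ((W.twistedTorsionGaloisModule p κ J u hu).tateDual (p ^ J)) g m - m := fun g ↦ hm g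
  -- `m|_{ker π}` is invariant: `(g m − m)(R) = (p^{J−j} φ(g))(R) = φ(g)(p^{J−j} R) = 0`
  have hmker : ∀ R : W.geomTorsion ((p ^ J : ℕ) : ℤ), W.twistedTorsionMulPow p κ hjJ u hu R = 0 → m R = 0 := by
    refine hinv m fun g R hR ↦ ?_
    rw [← hm' g]
    change ((p ^ (J - j) : ℕ) : ℤ) • φ.1 g R = 0
    rw [← map_zsmul]
    have hR' : ((p ^ (J - j) : ℕ) : ℤ) • R = 0 := by
      have h := congrArg (fun Q : W.geomTorsion ((p ^ j : ℕ) : ℤ) ↦ (Q : W.geomPoints)) hR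
      simp only [coe_twistedTorsionMulPow_apply, ZeroMemClass.coe_zero] at h
      exact Subtype.ext (by rw [AddSubgroupClass.coe_zsmul, ZeroMemClass.coe_zero]; exact h)
    rw [hR', map_zero]
  -- descend `m` through `π`: `m = m' ∘ π`
  obtain ⟨m', hm'π⟩ :=
    W.exists_tateDual_comp_twistedTorsionMulPow_eq_of_forall_apply_eq_zero p κ hjJ u hu hdiv hmker
  -- and `ι^D ∘ φ = ∂m'`
  rw [galoisCohomology.map_one_oneCocycleClass]
  refine (oneCocycleClass_eq_zero_iff _ _).mpr ⟨m', fun g ↦ ?_⟩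
  refine TateDual.ext fun S ↦ ?_
  obtain ⟨S₁, rfl⟩ := W.twistedTorsionMulPow_surjective p κ hjJ u hu hdiv S
  change W.twistedTorsionInclDual p κ hjJ u hu (φ.1 g) (W.twistedTorsionMulPow p κ hjJ u hu S₁) =
    ((W.twistedTorsionGaloisModule p κ j u hu).tateDual (p ^ J) g m' - m') (W.twistedTorsionMulPow p κ hjJ u hu S₁)
  rw [twistedTorsionInclDual_apply_apply, twistedTorsionIncl_mulPow, map_zsmul]
  have hL : ((p ^ (J - j) : ℕ) : ℤ) • φ.1 g S₁ =
      (((W.twistedTorsionGaloisModule p κ J u hu).tateDual (p ^ J)) g m - m) S₁ := by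
    rw [← hm' g]; rfl
  rw [hL]
  change (((W.twistedTorsionGaloisModule p κ J u hu).tateDual (p ^ J)) g m) S₁ - m S₁ =
    ((W.twistedTorsionGaloisModule p κ j u hu).tateDual (p ^ J) g m') (W.twistedTorsionMulPow p κ hjJ u hu S₁) -
      m' (W.twistedTorsionMulPow p κ hjJ u hu S₁)
  rw [hm'π, DiscreteGaloisModule.tateDual_apply_apply_apply, DiscreteGaloisModule.tateDual_apply_apply_apply,
    ← twistedTorsionMulPow_apply_twist, hm'π]

end Dual

end WeierstrassCurve

end
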